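import Literature.MathematicalPhysics.QuantumFieldTheory.Balaban1983to89.B6Prop26PrintedStage3KLevelV1
import Literature.MathematicalPhysics.QuantumFieldTheory.Balaban1983to89.B6Prop26HolderDivCensusV1
import Literature.MathematicalPhysics.QuantumFieldTheory.Balaban1983to89.B6Ineq2140Grad2KLevelV1
import HarnessLib

/-!
# `Balaban1983to89.B6Prop26PrintedStage4KLevelV1` — T. Bałaban, *Propagators and renormalization transformations for lattice gauge theories. II*,
Commun. Math. Phys. **96** (1984) 223–250 [Balaban1984PropagatorsII], Prop. 2.6 (2.136)–(2.141) p. 247: **`h26 = Prop26Printed` ON THE GENUINE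
k-LEVEL CENSUS MODULO THE TWO DISPLAYED SLOTS (2.138) AND (2.139) ONLY** — Stage 4 of the slot-discharge ladder.  Of the five displayed inputs of
`B6Prop26PrintedStage3KLevelV1.prop26Printed_kLevel_of_slots4` three are ALREADY theorems of the tree, with the displayed shapes character for
character (cell pub-ymgap dag-lead DEDUP №1/№2, 2026-08-25; confirmed here BY `exact` in the kernel):
* hm2 ((2.137)₂ pair majorant of `G∇*_ν` on the full admissible range) = `B6Prop26HolderDivCensusV1.prop26_2137_div_kLevel_admissible` (lit-balaban p38);
* hl4 ((2.140)₅ `∇_ν∇_μG`, exact-block `L²`) = `B6Ineq2140Grad2KLevelV1.ineq2140_grad2_kLevel_census` (lit-balaban p22);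
* hl5 ((2.140)₆ `G∇*_ν∇*_μ`, exact-block `L²`) = `B6Ineq2140Grad2KLevelV1.ineq2140_grad2T_kLevel_census` (lit-balaban p22);
(hl3 ((2.140)₄ `∇G∇*`) was discharged at Stage 3 by `B6Ineq2140GradGDivCensusKLevelV1.ineq2140_gradGDiv_kLevel_census`.)
Remaining displayed inputs: c3 ((2.138) `|(∇G∇*J)(x)| ≤ O(1)e^{−δ₃d(y,y′)}(‖J‖^{ξ′}_ε + |J|)` in the census reading `kG.e4`) and c4 ((2.139)
`‖ζ∇G∇*J‖_α ≤ O(1)(Lʲη)^{−α}(‖ζ‖^ξ_α + |ζ|)e^{−δ₃d(y,y′)}(‖J‖^{ξ′}_{α+ε} + |J|)` in the census reading `kG.h2`) — shapes verbatim.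
HONEST FRAMING (programme rule): statement-level skeleton of published theorems with citation tags; proofs where landed; nothing here is a claim about
the Yang–Mills mass gap.  One-line composition of named census theorems; THEOREMS ONLY; a T1 landing, NOT a node discharge; nothing continuum ∕
mass-gap ∕ Clay.  Seat `pub-ymgap-dag-p1` (prover, = n03-a), 2026-08-25.  NOT summit progress.
-/

namespace Literature.MathematicalPhysics.QuantumFieldTheory.Balaban1983to89.B6Prop26PrintedStage4KLevelV1

open B6KLevelCensusIndexV1 (KIdx kGeoG)
open B6Prop26Census2136KLevelV1 (kG)

open B6Prop26PrintedStage3KLevelV1 (prop26Printed_kLevel_of_slots4)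
open B6Prop26HolderDivCensusV1 (prop26_2137_div_kLevel_admissible)
open B6Ineq2140Grad2KLevelV1 (ineq2140_grad2_kLevel_census ineq2140_grad2T_kLevel_census)

variable {d ℓ : ℕ} {hd : 1 ≤ d + 1} {hL : Odd (ℓ + 1) ∧ 1 < ℓ + 1} {b₀ b₁ : ℝ}

noncomputable section

/-- **`h26` ON THE GENUINE k-LEVEL CENSUS, MODULO THE TWO DISPLAYED SLOTS (2.138) AND (2.139)** (c3, c4 — shapes of
`B6Prop26PrintedStage2KLevelV1.prop26Printed_kLevel_of_slots5` verbatim).  The other four displayed inputs are discharged BY NAME: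
hm2 := `prop26_2137_div_kLevel_admissible`, hl3 (inside Stage 3) := `ineq2140_gradGDiv_kLevel_census`, hl4 := `ineq2140_grad2_kLevel_census`,
hl5 := `ineq2140_grad2T_kLevel_census`.
[cite: Balaban1984PropagatorsII, Prop. 2.6 (2.136)–(2.141) p.247] -/
theorem prop26Printed_kLevel_of_slots2 (hb₀ : 0 < b₀) (hb₁ : b₀ ≤ b₁)
    (c3 : ∃ M₁ δ₃ : ℝ, ∃ Cε : ℝ → ℝ, 0 < M₁ ∧ 0 < δ₃ ∧ ∀ i : KIdx d ℓ hd hL b₀ b₁, M₁ ≤ (kGeoG i).M →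
      ∀ (ε : ℝ) (J : (kGeoG i).Loc) (y y' : (kGeoG i).Site), 0 < ε → ε < 1 → (kGeoG i).suppIn J y' →
        (kG i).e4 J y ≤ Cε ε * Real.exp (-(δ₃ * (kGeoG i).dist y y')) * ((kGeoG i).holder ε J + (kGeoG i).supNorm J))
    (c4 : ∃ M₁ δ₃ : ℝ, ∃ Cαε : ℝ → ℝ → ℝ, 0 < M₁ ∧ 0 < δ₃ ∧ ∀ i : KIdx d ℓ hd hL b₀ b₁, M₁ ≤ (kGeoG i).M →
      ∀ (α ε : ℝ) (J : (kGeoG i).Loc) (ζ : (kGeoG i).Cut) (y y' : (kGeoG i).Site), 0 ≤ α → 0 < ε → α + ε < 1 →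
        (kGeoG i).cutIn ζ y → (kGeoG i).suppIn J y' →
        (kG i).h2 J α ζ ≤ Cαε α ε * ((kGeoG i).len y) ^ (-α) * (kGeoG i).cutH α ζ * Real.exp (-(δ₃ * (kGeoG i).dist y y')) *
          ((kGeoG i).holder (α + ε) J + (kGeoG i).supNorm J)) :
    B6.Prop26Printed (fun i : KIdx d ℓ hd hL b₀ b₁ => kGeoG i) (fun i => kG i) :=
  prop26Printed_kLevel_of_slots4 hb₀ hb₁ (prop26_2137_div_kLevel_admissible d ℓ hd hL hb₀ hb₁)
    (ineq2140_grad2_kLevel_census d ℓ hd hL hb₀ hb₁) (ineq2140_grad2T_kLevel_census d ℓ hd hL hb₀ hb₁) c3 c4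

end

end Literature.MathematicalPhysics.QuantumFieldTheory.Balaban1983to89.B6Prop26PrintedStage4KLevelV1
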